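import Literature.Geometry.Kaehler.ComplexTorusPicZeroDolbeaultVanishing
import Literature.Geometry.Kaehler.ComplexTorusRadicalQuotient
import Literature.Analysis.Calculus.SmoothKernelIntegral
import Literature.Analysis.FunctionSpaces.TorusHolderSobolevEmbedding
import HarnessLib

/-!
# Fourier modes of the smooth sections of `L(H, χ)` along the subtorus `K(L)⁰`
# (the degenerate directions of Lange 2023, §1.6.3 / Theorem 1.6.8)

Layer `Literature/Geometry/Kaehler`, namespace `Literature.Geometry.Kaehler.ComplexTorus`; lane `lit-hodgefound`,
Layer A2 (seat `lit-hodgefound-skel-2`, generation 27), row **A2-94 FILE 1** of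
`run/shared/lean/pub/lit-hodgefound/SKELETON.md` — the first file of the programme "Theorem 1.6.1 and
Theorem 1.6.8 for a DEGENERATE line bundle `L = L(H, χ)` (`r + s < g`)" that continues rows A2-88 … A2-93
(positive and non-degenerate `L`, by the Fock expansion). DEFINITIONS WITH BODIES (`radChar`, `radSpace`,
`IsNSForm.radPeriod`, `radSlice`, `IsRadSection`, `IsNSForm.radTwistParam`, `IsNSForm.radTwist`, `IsNSForm.radFreq`,
`IsNSForm.radMode`, `radRepr`, `IsNSForm.radKernel`) and THEOREMS; no named fact, no `sorry`.

## The mathematics (Lange 2023 §1.6.3 with §1.5.4; the harmonic analysis is OURS, every step proved here)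

Let `X = V/Λ`, `L = L(H, χ)` with `H ∈ NS(X)` ARBITRARY, `E = Im H`, and let `Λ(L)⁰ = {v | H(v, V) = 0}` be the
radical (1.22), `Λ_0 = Λ ∩ Λ(L)⁰` (a lattice in `Λ(L)⁰`, Prop. 1.1.10), `K(L)⁰ = Λ(L)⁰/Λ_0` the complex subtorus of
§1.5.4 [p0058: "The group `K(L)⁰ = (Ker φ_L)⁰ = Λ(L)⁰/(Λ(L)⁰ ∩ Λ)⁰` is a complex subtorus of `X`"], of dimension
`g - r - s` in the notation of Thm. 1.6.8 [p0068: "`h^q(L) = binom(g-r-s, q-s) Pfr(E)` if `s ≤ q ≤ g - r` and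
`L|_{K(L)^0}` is trivial; `0` otherwise"]. Lange's proof of 1.6.8 decomposes `V = V_+ ⊕ V_- ⊕ Λ(L)⁰` (1.29) and
works on harmonic forms, quoting Thm. 1.6.1 (`H^q ≅ ℋ^q`) from Griffiths–Harris. To PROVE Thm. 1.6.1 for
degenerate `L` on the tree's carriers (rows A2-77/A2-79: `A^{0,0}(L) = smoothTheta`, `∂̄_w`, `δ̄_w`, `Δ_I`) one
needs the harmonic analysis of `A^{0,0}(L)` along `K(L)⁰`, which is this file:

* On `Λ_0` the canonical factor of `L` IS the character `χ_0 = χ|_{Λ_0}` (`H(·, λ) = 0` for `λ ∈ Λ(L)⁰`):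
  `a_L(λ, v) = χ(λ)` (`canonicalFactor_subtorusMatrix_mulVec`), and `χ_0` is multiplicative
  (`isSemicharacter_radChar`) — so `L|_{K(L)⁰} = L(0, χ_0) ∈ Pic⁰(K(L)⁰)`, trivial iff `χ_0 = 1` (the condition
  "`L|_{K(L)^0}` is trivial" of Thm. 1.6.8).
* Hence the slices `w ↦ f(x + w)` (`radSlice`) of a smooth section `f` of `L` are smooth sections of the flat
  bundle `L(0, χ_0)` on `K(L)⁰` (`radSlice_mem_smoothTheta`), to which row A2-82
  (`ComplexTorusPicZeroDolbeaultVanishing`: `χ_0 = e(2πiθ)|_{Λ_0}`, twisted Fourier coefficients `twCoeff`,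
  synthesis `twSynth_twCoeff`) applies: the **modes** `f^(m)(x) = (f_x)^θ(m)`, `m ∈ ℤ^{rk Λ_0}` (`IsNSForm.radMode`).
* `f(x) = Σ_m f^(m)(x)` absolutely (`IsRadSection.hasSum_radMode`); `f = 0` iff all modes vanish; the modes are
  joint eigenfunctions of the `K(L)⁰`-translations, `f^(m)(x + w) = e(2πi(θ + ρ_m)(w)) f^(m)(x)`
  (`IsRadSection.radMode_add_coe`), `C^∞` in `x` (`contDiff_radMode`, differentiation under the integral sign,
  the tree's `Literature.Analysis.Calculus.contDiff_integral_kernel_mul`), and again smooth sections of `L`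
  (`IsNSForm.radMode_mem_smoothTheta`);
* every real derivative commutes with taking modes (`fderiv_radMode_apply`, `dbarAlong_radMode`,
  `delAlong_radMode`, `deltaBar_radMode`), hence so does Lange's Laplacian `Δ_I` of Prop. 1.6.3
  (`IsRadSection.laplaceI_radMode`), while along the radical the modes DIAGONALISE the first-order operators:
  `∂̄_w f^(m) = πi c_w(θ + ρ_m) f^(m)`, `∂_w f^(m) = πi \overline{c_w(θ + ρ_m)} f^(m)`, `δ̄_w = -∂_w` and
  `δ̄_w ∂̄_w f^(m) = π² |c_w(θ + ρ_m)|² f^(m)` for `w ∈ Λ(L)⁰` (`dbarAlong_coe_radMode`, `delAlong_coe_radMode`,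
  `deltaBar_coe_radSpace`, `deltaBar_dbarAlong_coe_radMode`), with the symbol `c_w(ρ) = ρ(w) + iρ(iw)` of row A2-82.

The class on which this calculus runs is `IsRadSection` ("`C^∞` and `f(z + λ) = χ_0(λ) f(z)` for `λ ∈ Λ_0`"): it
contains `A^{0,0}(L)` and, unlike `A^{0,0}(L)`, is stable under `z ↦ Df(z)[v]`, `∂̄_v`, `∂_v`, `H(v, ·)·`.
What is NOT here (next files of the programme): the descent of the modes to sections of `L̄ ⊗ P_m` on
`X̄ = X/K(L)⁰` (tree `ComplexTorusRadicalQuotient`, `ComplexTorusSemipositiveLineBundleDescent`), the joint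
(mode ⊗ Fock) expansion with its synthesis estimates, the Green operator and Thm. 1.6.1 / 1.6.8 themselves.

## Dictionary

`Φ : (ι → ℝ) ≃L[ℝ] E` the period isomorphism of `X`, `η = E = Im H` (`IsNSForm Φ η`), `χ` (`IsSemicharacter Φ η χ`);
`nsRadical Φ η = Λ(L)⁰` in lattice coordinates and `C = subtorusMatrix (nsRadical Φ η)` the adapted `ℤ`-basis of
`Λ_0` (rows A1-19 / Layer-A `ComplexTorusSubtorusQuotient`, `ComplexTorusRadicalQuotient`), `r = subRank (nsRadical Φ η)
= rk Λ_0`; `radSpace Φ η = Φ(Λ(L)⁰) ⊆ V` (`cxSpan`), `hη.radPeriod : ℝ^r ≃ Φ(Λ(L)⁰)` the period map of `K(L)⁰`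
(`subtorusPeriod`), so `K(L)⁰ = ComplexTorus hη.radPeriod`; `radChar Φ η χ n = χ(C n) = χ_0`;
`hη.radTwist hχ = θ` with `χ_0(n) = e(2πi θ(λ^K_n))` (`radChar_eq_twistExp`), `hη.radFreq m = ρ_m`;
`hη.radMode hχ f m x = f^(m)(x) = twCoeff hη.radPeriod θ (radSlice Φ η f x) m`; `radRepr`, `hη.radKernel hχ f` write
`f^(m)(x) = ∫_{K(L)⁰} A_f(x, s_y) \overline{e_m(y)} dy` (`radMode_eq_integral`).

## References

* [Lange2023AbelianVarietiesComplex] H. Lange, *Abelian Varieties over the Complex Numbers*, Grundlehren Text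
  Edition, Springer 2023 — §1.5.4 (1.22) and "`K(L)⁰` is a complex subtorus" [p0058]; §1.6.1 Lemma 1.6.2,
  Prop. 1.6.3 [p0063–p0065]; §1.6.3 (1.29)–(1.31), Thm. 1.6.8, Prop. 1.6.10, Prop. 1.6.11 [p0068–p0070];
  §1.4.1 Prop. 1.4.1 [p0042]; §1.3.1 (1.10)–(1.11).
* [Grafakos2014] L. Grafakos, *Classical Fourier Analysis*, 3rd ed., GTM 249 (2014), §3.1.1 (3.1.4),
  Prop. 3.1.2 (1), (6), (8), Prop. 3.2.4, Prop. 3.2.5.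
* [LangeBirkenhake1992] H. Lange, Ch. Birkenhake, *Complex Abelian Varieties* (1992), §1.1.4.

[cite: Lange2023AbelianVarietiesComplex, §1.6.3 Thm. 1.6.8] [cite: Lange2023AbelianVarietiesComplex, §1.5.4 (1.22)]
-/

noncomputable section

open scoped Manifold ContDiff Topology Real ComplexConjugate Matrix
open Set Function Complex Finset Module UnitAddTorus
open Literature.Analysis.Complex Literature.Analysis.FunctionSpaces

namespace Literature.Geometry.Kaehler

namespace ComplexTorus

/-! ## §1 The lattice `Λ_0 = Λ ∩ Λ(L)⁰` of the radical, the character `χ|_{Λ_0}` and the period map of `K(L)⁰` -/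

section RadicalLattice

variable {ι : Type*} [Fintype ι] [DecidableEq ι] {E : Type*} [NormedAddCommGroup E] [NormedSpace ℂ E]
  (Φ : (ι → ℝ) ≃L[ℝ] E) (η : E [⋀^Fin 2]→L[ℝ] ℝ) (χ : (ι → ℤ) → ℂ)

omit [Fintype ι] [DecidableEq ι] in
/-- Integer `mulVec` read in `ℝ^ι`: `(C n : ℝ^ι) = C_ℝ (n : ℝ^r)`. [folklore] -/
private theorem intCast_mulVec_eq {r : ℕ} (C : Matrix ι (Fin r) ℤ) (n : Fin r → ℤ) :
    (fun i ↦ ((C *ᵥ n) i : ℝ)) = C.map (Int.cast : ℤ → ℝ) *ᵥ fun j ↦ (n j : ℝ) := by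
  ext i
  simp [Matrix.mulVec, dotProduct, Matrix.map_apply]

omit [DecidableEq ι] in
/-- **The lattice vectors of the radical**: `λ_{C n} = Φ(C n) ∈ Λ ∩ Λ(L)⁰` for the adapted basis matrix
`C = subtorusMatrix (Λ(L)⁰)` of `Λ(L)⁰ ∩ Λ` — `E(λ_{Cn}, v) = 0` for every `v ∈ V`.
[cite: Lange2023AbelianVarietiesComplex, §1.5.4 (1.22)] -/
theorem apply_latticeVec_subtorusMatrix_mulVec (n : Fin (subRank (nsRadical Φ η)) → ℤ) (v : E) :
    η ![latticeVec Φ (subtorusMatrix (nsRadical Φ η) *ᵥ n), v] = 0 := by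
  have hmem : (subtorusMatrix (nsRadical Φ η)).map (Int.cast : ℤ → ℝ) *ᵥ (fun j ↦ (n j : ℝ)) ∈ nsRadical Φ η :=
    subtorusMatrix_mulVec_mem _ _
  rw [mem_nsRadical_iff_forall] at hmem
  have h := hmem v
  rwa [← intCast_mulVec_eq] at h

omit [DecidableEq ι] in
/-- `H(v, λ_{Cn}) = 0`: the radical lattice vectors are `H`-orthogonal to everything (`η` of type `(1,1)`).
[cite: Lange2023AbelianVarietiesComplex, §1.5.4 (1.22)] -/
theorem hermOf_latticeVec_subtorusMatrix_mulVec (h11 : ∀ u v : E, η ![I • u, I • v] = η ![u, v])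
    (v : E) (n : Fin (subRank (nsRadical Φ η)) → ℤ) :
    hermOf η v (latticeVec Φ (subtorusMatrix (nsRadical Φ η) *ᵥ n)) = 0 := by
  have hmem : (subtorusMatrix (nsRadical Φ η)).map (Int.cast : ℤ → ℝ) *ᵥ (fun j ↦ (n j : ℝ)) ∈ nsRadical Φ η :=
    subtorusMatrix_mulVec_mem _ _
  rw [mem_nsRadical_iff_hermOf Φ h11] at hmem
  have h := hmem v
  rw [← intCast_mulVec_eq] at h
  -- `H(λ, v) = 0 ⟹ H(v, λ) = conj 0 = 0`
  rw [hermOf_swap η h11, show Φ (fun i ↦ ((subtorusMatrix (nsRadical Φ η) *ᵥ n) i : ℝ)) =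
    latticeVec Φ (subtorusMatrix (nsRadical Φ η) *ᵥ n) from rfl, map_eq_zero] at h
  exact h

omit [DecidableEq ι] in
/-- `H(λ_{Cn}, v) = 0` as well. [cite: Lange2023AbelianVarietiesComplex, §1.5.4 (1.22)] -/
theorem hermOf_latticeVec_subtorusMatrix_mulVec_left (h11 : ∀ u v : E, η ![I • u, I • v] = η ![u, v])
    (n : Fin (subRank (nsRadical Φ η)) → ℤ) (v : E) :
    hermOf η (latticeVec Φ (subtorusMatrix (nsRadical Φ η) *ᵥ n)) v = 0 := by
  rw [hermOf_swap η h11, hermOf_latticeVec_subtorusMatrix_mulVec Φ η h11, map_zero]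

/-- **The restriction `χ_0 = χ|_{Λ_0}` of the semicharacter to the radical lattice**, in the adapted basis:
`χ_0(n) = χ(C n)`. [cite: Lange2023AbelianVarietiesComplex, §1.6.3 Prop. 1.6.11 ("the semi-character is the same")] -/
def radChar (n : Fin (subRank (nsRadical Φ η)) → ℤ) : ℂ := χ (subtorusMatrix (nsRadical Φ η) *ᵥ n)

omit [DecidableEq ι] in
/-- Unfolding of `radChar`. [cite: Lange2023AbelianVarietiesComplex, §1.6.3 Prop. 1.6.11] -/
theorem radChar_apply (n : Fin (subRank (nsRadical Φ η)) → ℤ) :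
    radChar Φ η χ n = χ (subtorusMatrix (nsRadical Φ η) *ᵥ n) := rfl

variable {Φ η χ}

omit [DecidableEq ι] in
/-- **On the radical lattice the canonical factor IS the character**: `a_L(C n, v) = χ(C n) = χ_0(n)`
(`H(v, λ) = H(λ, λ) = 0` for `λ ∈ Λ(L)⁰`). [cite: Lange2023AbelianVarietiesComplex, §1.3.1 (1.11)] [cite: Lange2023AbelianVarietiesComplex, §1.5.4 (1.22)] -/
theorem canonicalFactor_subtorusMatrix_mulVec (h11 : ∀ u v : E, η ![I • u, I • v] = η ![u, v])
    (n : Fin (subRank (nsRadical Φ η)) → ℤ) (v : E) :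
    canonicalFactor Φ η χ (subtorusMatrix (nsRadical Φ η) *ᵥ n) v = radChar Φ η χ n := by
  rw [canonicalFactor_apply, hermOf_latticeVec_subtorusMatrix_mulVec Φ η h11,
    hermOf_latticeVec_subtorusMatrix_mulVec Φ η h11, radChar_apply]
  simp

omit [DecidableEq ι] in
/-- **`χ_0` is a CHARACTER of `Λ_0 ≅ ℤ^r`** (a semicharacter for the zero form): `E` vanishes on `Λ(L)⁰`, so
the cocycle factor `e(πi E(λ, μ))` in (1.10) is `1`. [cite: Lange2023AbelianVarietiesComplex, §1.3.1 (1.10)] -/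
theorem isSemicharacter_radChar (hχ : IsSemicharacter Φ η χ) {F : Type*} [NormedAddCommGroup F] [NormedSpace ℂ F]
    (Ψ : (Fin (subRank (nsRadical Φ η)) → ℝ) ≃L[ℝ] F) :
    IsSemicharacter Ψ 0 (radChar Φ η χ) where
  norm_eq_one n := by rw [radChar_apply]; exact hχ.norm_eq_one _
  map_add n m := by
    rw [radChar_apply, radChar_apply, radChar_apply, Matrix.mulVec_add, hχ.map_add,
      apply_latticeVec_subtorusMatrix_mulVec]
    simp

/-! ## §2 `K(L)⁰ = Φ(Λ(L)⁰)/Λ_0` as a complex torus; the slices `w ↦ f(x + w)` of a smooth section of `L`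
are smooth sections of the flat bundle `L(0, χ_0)` on `K(L)⁰` -/

variable (Φ η) in
/-- The complex subspace `Φ(Λ(L)⁰) ⊆ V` spanned by the radical (as a `ℂ`-submodule of `E`).
[cite: Lange2023AbelianVarietiesComplex, §1.6.3 (1.29) (`Λ(L)^0 = ⟨e_{r+s+1}, …, e_g⟩`)] -/
abbrev radSpace : Submodule ℂ E := cxSpan Φ (nsRadical Φ η)

/-- **The period isomorphism of the subtorus `K(L)⁰`**: `ℝ^r ≃ Φ(Λ(L)⁰)`, `r = rk Λ_0`, the adapted basis
of `Λ_0 = Λ ∩ Λ(L)⁰` as lattice basis (row A1-19's `subtorusPeriod` at `W = Λ(L)⁰`, a lattice subspace by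
Prop. 1.1.10 and a complex one for `η` of type `(1,1)`); `K(L)⁰ = ComplexTorus (hη.radPeriod)`.
[cite: Lange2023AbelianVarietiesComplex, §1.5.4 ("`K(L)⁰` … is a complex subtorus of `X`"), p. 58] -/
abbrev IsNSForm.radPeriod (hη : IsNSForm Φ η) : (Fin (subRank (nsRadical Φ η)) → ℝ) ≃L[ℝ] radSpace Φ η :=
  subtorusPeriod Φ (nsRadical Φ η) hη.isLatticeSubspace_nsRadical (isComplexSubspace_nsRadical Φ hη.type_one_one)

/-- The lattice vectors of `K(L)⁰` are the radical lattice vectors of `X`: `(λ^K_n : V) = λ_{C n}`.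
[cite: Lange2023AbelianVarietiesComplex, §1.1.6 Exercise (2)(a)] -/
theorem IsNSForm.coe_latticeVec_radPeriod (hη : IsNSForm Φ η) (n : Fin (subRank (nsRadical Φ η)) → ℤ) :
    ((latticeVec hη.radPeriod n : radSpace Φ η) : E) = latticeVec Φ (subtorusMatrix (nsRadical Φ η) *ᵥ n) := by
  rw [latticeVec, latticeVec, intCast_mulVec_eq]
  rfl

variable (Φ η) in
/-- **The slice of a function along the radical through `x`**: `f_x(w) = f(x + w)`, `w ∈ Φ(Λ(L)⁰)`.
[cite: Lange2023AbelianVarietiesComplex, §1.6.3 Prop. 1.6.10 (1.29)] -/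
def radSlice (f : E → ℂ) (x : E) : radSpace Φ η → ℂ := fun w ↦ f (x + w)

omit [Fintype ι] [DecidableEq ι] in
/-- Unfolding of `radSlice`. [cite: Lange2023AbelianVarietiesComplex, §1.6.3 (1.29)] -/
theorem radSlice_apply (f : E → ℂ) (x : E) (w : radSpace Φ η) : radSlice Φ η f x w = f (x + w) := rfl

omit [Fintype ι] [DecidableEq ι] in
/-- The slice map `w ↦ x + w` is smooth (affine). [folklore] -/
private theorem contDiff_const_add_subtype (x : E) : ContDiff ℝ ∞ fun w : radSpace Φ η ↦ x + (w : E) :=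
  contDiff_const.add ((radSpace Φ η).subtypeL.restrictScalars ℝ).contDiff

omit [Fintype ι] [DecidableEq ι] in
/-- Slices of smooth functions are smooth. [cite: Lange2023AbelianVarietiesComplex, §1.6.3 (1.29)] -/
theorem contDiff_radSlice {f : E → ℂ} (hf : ContDiff ℝ ∞ f) (x : E) : ContDiff ℝ ∞ (radSlice Φ η f x) :=
  hf.comp (contDiff_const_add_subtype x)

/-- **The slices of a smooth section of `L = L(H, χ)` are smooth sections of the flat bundle `L(0, χ_0)` on
`K(L)⁰`**: `f_x(w + λ^K_n) = χ_0(n) f_x(w)` (the canonical factor of `L` at a radical lattice vector is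
`χ_0`, `canonicalFactor_subtorusMatrix_mulVec`). This is the restriction `L|_{K(L)⁰} ∈ Pic⁰(K(L)⁰)` of
Theorem 1.6.8 ("… and `L|_{K(L)^0}` is trivial"). [cite: Lange2023AbelianVarietiesComplex, §1.6.3 Thm. 1.6.8] -/
theorem radSlice_mem_smoothTheta (hη : IsNSForm Φ η) {f : E → ℂ}
    (hf : f ∈ smoothTheta Φ (canonicalFactor Φ η χ)) (x : E) :
    radSlice Φ η f x ∈ smoothTheta hη.radPeriod (canonicalFactor hη.radPeriod 0 (radChar Φ η χ)) := by
  refine ⟨contDiff_radSlice hf.1 x, fun n w ↦ ?_⟩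
  rw [canonicalFactor_zero, radSlice_apply, radSlice_apply, Submodule.coe_add, hη.coe_latticeVec_radPeriod,
    ← add_assoc, hf.2, canonicalFactor_subtorusMatrix_mulVec hη.type_one_one]

omit [Fintype ι] [DecidableEq ι] in
/-- Slices of a translate along the radical: `f_{x + w}(w') = f_x(w + w')`. [folklore] -/
private theorem radSlice_add_coe (f : E → ℂ) (x : E) (w w' : radSpace Φ η) :
    radSlice Φ η f (x + w) w' = radSlice Φ η f x (w + w') := by
  simp [radSlice_apply, add_assoc]

end RadicalLattice

/-! ## §3 Radical sections: smooth functions with `f(z + λ) = χ_0(λ) f(z)` for the radical lattice vectors -/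

section RadSection

variable {ι : Type*} [Fintype ι] [DecidableEq ι] {E : Type*} [NormedAddCommGroup E] [NormedSpace ℂ E]
  {Φ : (ι → ℝ) ≃L[ℝ] E} {η : E [⋀^Fin 2]→L[ℝ] ℝ} {χ : (ι → ℤ) → ℂ}

variable (Φ η χ) in
/-- **Radical sections**: `C^∞` functions on `V` with `f(z + λ_{Cn}) = χ_0(n) f(z)` for the lattice vectors of
the radical. Every smooth section of `L(H, χ)` is one (`IsRadSection.of_mem_smoothTheta`), and — unlike
`A^{0,0}(L)` — the class is stable under all real derivatives `z ↦ Df(z)[v]` (`IsRadSection.fderiv_apply`),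
which is what makes the mode calculus of §5 run. [cite: Lange2023AbelianVarietiesComplex, §1.6.3 Prop. 1.6.10 (Step 1)] -/
structure IsRadSection (f : E → ℂ) : Prop where
  contDiff : ContDiff ℝ ∞ f
  periodic : ∀ (n : Fin (subRank (nsRadical Φ η)) → ℤ) (z : E),
    f (z + latticeVec Φ (subtorusMatrix (nsRadical Φ η) *ᵥ n)) = radChar Φ η χ n * f z

omit [DecidableEq ι] in
/-- Smooth sections of `L(H, χ)` are radical sections. [cite: Lange2023AbelianVarietiesComplex, §1.6.3 Prop. 1.6.10 (Step 1)] -/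
theorem IsRadSection.of_mem_smoothTheta (h11 : ∀ u v : E, η ![I • u, I • v] = η ![u, v]) {f : E → ℂ}
    (hf : f ∈ smoothTheta Φ (canonicalFactor Φ η χ)) : IsRadSection Φ η χ f :=
  ⟨hf.1, fun n z ↦ by rw [hf.2, canonicalFactor_subtorusMatrix_mulVec h11]⟩

omit [DecidableEq ι] in
/-- The zero function is a radical section. [cite: Lange2023AbelianVarietiesComplex, §1.6.3 Prop. 1.6.10 (Step 1)] -/
theorem IsRadSection.zero : IsRadSection Φ η χ (0 : E → ℂ) := ⟨contDiff_const, fun n z ↦ by simp⟩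

omit [DecidableEq ι] in
/-- Sums of radical sections. [cite: Lange2023AbelianVarietiesComplex, §1.6.3 Prop. 1.6.10 (Step 1)] -/
theorem IsRadSection.add {f g : E → ℂ} (hf : IsRadSection Φ η χ f) (hg : IsRadSection Φ η χ g) :
    IsRadSection Φ η χ (f + g) :=
  ⟨hf.contDiff.add hg.contDiff, fun n z ↦ by simp only [Pi.add_apply, hf.periodic, hg.periodic, mul_add]⟩

omit [DecidableEq ι] in
/-- Scalar multiples of radical sections. [cite: Lange2023AbelianVarietiesComplex, §1.6.3 Prop. 1.6.10 (Step 1)] -/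
theorem IsRadSection.const_mul {f : E → ℂ} (hf : IsRadSection Φ η χ f) (c : ℂ) :
    IsRadSection Φ η χ (fun z ↦ c * f z) :=
  ⟨contDiff_const.mul hf.contDiff, fun n z ↦ by simp only [hf.periodic]; ring⟩

omit [DecidableEq ι] in
/-- Finite sums of radical sections. [cite: Lange2023AbelianVarietiesComplex, §1.6.3 Prop. 1.6.10 (Step 1)] -/
theorem IsRadSection.finset_sum {α : Type*} (s : Finset α) {F : α → E → ℂ}
    (hF : ∀ i ∈ s, IsRadSection Φ η χ (F i)) : IsRadSection Φ η χ (fun z ↦ ∑ i ∈ s, F i z) := by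
  classical
  induction s using Finset.induction_on with
  | empty =>
    simp only [Finset.sum_empty]
    exact IsRadSection.zero
  | insert a s ha ih =>
    simp only [Finset.sum_insert ha]
    exact (hF a (Finset.mem_insert_self a s)).add (ih fun i hi ↦ hF i (Finset.mem_insert_of_mem hi))

omit [DecidableEq ι] in
/-- **Radical sections are stable under directional derivatives** `z ↦ Df(z)[v]` (the factor `χ_0(n)` is
constant in `z`). [cite: Lange2023AbelianVarietiesComplex, §1.6.3 Prop. 1.6.10 (Step 1)] -/
theorem IsRadSection.fderiv_apply {f : E → ℂ} (hf : IsRadSection Φ η χ f) (v : E) :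
    IsRadSection Φ η χ (fun z ↦ fderiv ℝ f z v) := by
  refine ⟨?_, fun n z ↦ ?_⟩
  · exact (hf.contDiff.fderiv_right (m := ∞) (by norm_cast)).clm_apply contDiff_const
  · have hper : (fun z ↦ f (z + latticeVec Φ (subtorusMatrix (nsRadical Φ η) *ᵥ n))) =
        fun z ↦ radChar Φ η χ n * f z := funext (hf.periodic n)
    have hd : DifferentiableAt ℝ f (z + latticeVec Φ (subtorusMatrix (nsRadical Φ η) *ᵥ n)) :=
      (hf.contDiff.differentiable (by simp)) _
    have h1 : fderiv ℝ (fun z ↦ f (z + latticeVec Φ (subtorusMatrix (nsRadical Φ η) *ᵥ n))) z =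
        fderiv ℝ f (z + latticeVec Φ (subtorusMatrix (nsRadical Φ η) *ᵥ n)) := by
      rw [fderiv_comp_add_right]
    have h2 : fderiv ℝ (fun z ↦ radChar Φ η χ n * f z) z = radChar Φ η χ n • fderiv ℝ f z := by
      exact fderiv_const_mul ((hf.contDiff.differentiable (by simp)) z) _
    have h := congrArg (fun L : E →L[ℝ] ℂ ↦ L v) (h1.symm.trans (by rw [hper, h2]))
    simpa using h

omit [DecidableEq ι] in
/-- Radical sections are stable under `∂̄_v`. [cite: Lange2023AbelianVarietiesComplex, §1.6.1 Lemma 1.6.2] -/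
theorem isRadSection_dbarAlong {f : E → ℂ} (hf : IsRadSection Φ η χ f) (v : E) :
    IsRadSection Φ η χ (dbarAlong v f) := by
  have h : dbarAlong v f = fun z ↦ (1 / 2 : ℂ) * (fderiv ℝ f z v + I * fderiv ℝ f z (I • v)) := by
    funext z; rw [dbarAlong]; simp
  rw [h]
  refine IsRadSection.const_mul ?_ _
  have h1 := hf.fderiv_apply v
  have h2 := (hf.fderiv_apply (I • v)).const_mul I
  exact ⟨h1.contDiff.add h2.contDiff, fun n z ↦ by rw [h1.periodic, h2.periodic]; ring⟩

omit [DecidableEq ι] in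
/-- Radical sections are stable under `∂_v`. [cite: Lange2023AbelianVarietiesComplex, §1.6.1 Lemma 1.6.2] -/
theorem isRadSection_delAlong {f : E → ℂ} (hf : IsRadSection Φ η χ f) (v : E) :
    IsRadSection Φ η χ (delAlong v f) := by
  have h : delAlong v f = fun z ↦ (1 / 2 : ℂ) * (fderiv ℝ f z v + (-I) * fderiv ℝ f z (I • v)) := by
    funext z; rw [delAlong]; simp; ring
  rw [h]
  refine IsRadSection.const_mul ?_ _
  have h1 := hf.fderiv_apply v
  have h2 := (hf.fderiv_apply (I • v)).const_mul (-I)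
  exact ⟨h1.contDiff.add h2.contDiff, fun n z ↦ by rw [h1.periodic, h2.periodic]; ring⟩

/-- The slices of a radical section are smooth sections of `L(0, χ_0)` on `K(L)⁰`.
[cite: Lange2023AbelianVarietiesComplex, §1.6.3 Thm. 1.6.8] -/
theorem IsRadSection.radSlice_mem (hη : IsNSForm Φ η) {f : E → ℂ} (hf : IsRadSection Φ η χ f) (x : E) :
    radSlice Φ η f x ∈ smoothTheta hη.radPeriod (canonicalFactor hη.radPeriod 0 (radChar Φ η χ)) := by
  refine ⟨contDiff_radSlice hf.contDiff x, fun n w ↦ ?_⟩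
  rw [canonicalFactor_zero, radSlice_apply, radSlice_apply, Submodule.coe_add, hη.coe_latticeVec_radPeriod,
    ← add_assoc, hf.periodic]

end RadSection

/-! ## §4 The twist `θ` with `χ_0 = e(2πiθ)|_{Λ_0}` and the Fourier modes of a radical section along `K(L)⁰` -/

section Modes

variable {ι : Type*} [Fintype ι] [DecidableEq ι] {E : Type*} [NormedAddCommGroup E] [NormedSpace ℂ E]
  {Φ : (ι → ℝ) ≃L[ℝ] E} {η : E [⋀^Fin 2]→L[ℝ] ℝ} {χ : (ι → ℤ) → ℂ}

/-- `χ_0` is a character of the lattice of `K(L)⁰`. [cite: Lange2023AbelianVarietiesComplex, §1.3.1 (1.10)] -/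
theorem IsNSForm.isSemicharacter_radChar (hη : IsNSForm Φ η) (hχ : IsSemicharacter Φ η χ) :
    IsSemicharacter hη.radPeriod 0 (radChar Φ η χ) :=
  ComplexTorus.isSemicharacter_radChar hχ _

/-- **The twist parameter**: `t ∈ ℝ^r` with `χ_0(n) = e(2πi Σ tᵢ nᵢ)` (Prop. 1.4.1: every character of a lattice
is `e(2πi⟨ℓ, ·⟩)`; a choice). [cite: Lange2023AbelianVarietiesComplex, §1.4.1 Prop. 1.4.1] -/
def IsNSForm.radTwistParam (hη : IsNSForm Φ η) (hχ : IsSemicharacter Φ η χ) :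
    Fin (subRank (nsRadical Φ η)) → ℝ :=
  (exists_coordFunctional_of_isSemicharacter_zero hη.radPeriod (hη.isSemicharacter_radChar hχ)).choose

/-- **The twist functional `θ : Φ(Λ(L)⁰) → ℝ`**, real-linear, with `χ_0 = e(2πiθ)` on `Λ_0`
(`radChar_eq_twistExp`). [cite: Lange2023AbelianVarietiesComplex, §1.4.1 Prop. 1.4.1] -/
def IsNSForm.radTwist (hη : IsNSForm Φ η) (hχ : IsSemicharacter Φ η χ) : radSpace Φ η →L[ℝ] ℝ :=
  coordFunctional hη.radPeriod (hη.radTwistParam hχ)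

/-- `χ_0(n) = e(2πi θ(λ^K_n))`. [cite: Lange2023AbelianVarietiesComplex, §1.4.1 Prop. 1.4.1] -/
theorem IsNSForm.radChar_eq_twistExp (hη : IsNSForm Φ η) (hχ : IsSemicharacter Φ η χ)
    (n : Fin (subRank (nsRadical Φ η)) → ℤ) :
    radChar Φ η χ n = twistExp (hη.radTwist hχ) (latticeVec hη.radPeriod n) :=
  (exists_coordFunctional_of_isSemicharacter_zero hη.radPeriod (hη.isSemicharacter_radChar hχ)).choose_spec n

/-- The functional `ρ_m = Σ mᵢ uᵢ` of an integer frequency `m ∈ ℤ^r` on `Φ(Λ(L)⁰)` (in the adapted lattice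
coordinates `u` of `K(L)⁰`). [cite: Grafakos2014, §3.1.1] -/
abbrev IsNSForm.radFreq (hη : IsNSForm Φ η) (m : Fin (subRank (nsRadical Φ η)) → ℤ) : radSpace Φ η →L[ℝ] ℝ :=
  coordFunctional hη.radPeriod fun i ↦ (m i : ℝ)

/-- **The characters of `K(L)⁰` read on `Φ(Λ(L)⁰)`**: `e_m(π w) = e(2πi ρ_m(w))`. [cite: Grafakos2014, §3.1.1] -/
theorem IsNSForm.mFourier_cover_radPeriod (hη : IsNSForm Φ η) (m : Fin (subRank (nsRadical Φ η)) → ℤ)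
    (w : radSpace Φ η) :
    (mFourier m (cover hη.radPeriod w) : ℂ) = twistExp (hη.radFreq m) w := by
  rw [cover_apply, twistExp_apply, coordFunctional_apply]
  simp only [mFourier, ContinuousMap.coe_mk, proj_apply, fourier_coe_apply]
  rw [← Complex.exp_sum]
  congr 1
  push_cast
  rw [Finset.mul_sum]
  exact Finset.sum_congr rfl fun a _ ↦ by ring

/-- **The Fourier modes of a function along `K(L)⁰`**: `f^(m)(x) = (f_x)^θ(m)`, the `m`-th twisted Fourier
coefficient (row A2-82 `twCoeff`) of the slice `w ↦ f(x + w)` — `f^(m)(x) = ∫_{K(L)⁰} f(x + w) e(-2πi(θ + ρ_m)(w)) dw`.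
[cite: Lange2023AbelianVarietiesComplex, §1.6.3 Prop. 1.6.10] [cite: Grafakos2014, §3.1.1 (3.1.4)] -/
def IsNSForm.radMode (hη : IsNSForm Φ η) (hχ : IsSemicharacter Φ η χ) (f : E → ℂ)
    (m : Fin (subRank (nsRadical Φ η)) → ℤ) (x : E) : ℂ :=
  twCoeff hη.radPeriod (hη.radTwist hχ) (radSlice Φ η f x) m

/-- Unfolding of `radMode`. [cite: Lange2023AbelianVarietiesComplex, §1.6.3 Prop. 1.6.10] -/
theorem IsNSForm.radMode_apply (hη : IsNSForm Φ η) (hχ : IsSemicharacter Φ η χ) (f : E → ℂ)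
    (m : Fin (subRank (nsRadical Φ η)) → ℤ) (x : E) :
    hη.radMode hχ f m x = twCoeff hη.radPeriod (hη.radTwist hχ) (radSlice Φ η f x) m := rfl

/-- **Fourier inversion at the base point: `f(x) = Σ_m f^(m)(x)`** (absolutely convergent) for a radical section
`f` — the slice `f_x ∈ A^{0,0}(L(0, χ_0))` on `K(L)⁰` is the synthesis of its rapidly decaying twisted
coefficients (row A2-82 `twSynth_twCoeff`), read at `w = 0`. [cite: Grafakos2014, Prop. 3.2.5] [cite: Lange2023AbelianVarietiesComplex, §1.6.3 Prop. 1.6.10] -/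
theorem IsRadSection.hasSum_radMode (hη : IsNSForm Φ η) (hχ : IsSemicharacter Φ η χ) {f : E → ℂ}
    (hf : IsRadSection Φ η χ f) (x : E) :
    HasSum (fun m ↦ hη.radMode hχ f m x) (f x) := by
  have hφ := hf.radSlice_mem hη x
  have hχθ := hη.radChar_eq_twistExp hχ
  have hc : Torus.RapidDecay (twCoeff hη.radPeriod (hη.radTwist hχ) (radSlice Φ η f x)) :=
    rapidDecay_twCoeff hχθ hφ
  have hsynth := twSynth_twCoeff hχθ hφ
  have h0 := congrFun hsynth 0
  rw [radSlice_apply, Submodule.coe_zero, add_zero] at h0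
  -- `twSynth c 0 = Σ_m c_m`
  have h1 : twSynth hη.radPeriod (hη.radTwist hχ) (twCoeff hη.radPeriod (hη.radTwist hχ) (radSlice Φ η f x)) 0 =
      Torus.fourierSynth (twCoeff hη.radPeriod (hη.radTwist hχ) (radSlice Φ η f x)) (cover hη.radPeriod 0) := by
    simp [twSynth, retwist_apply, twistExp_apply, perSynth, torusSynth]
  have hsum := hc.hasSum_fourierSynth (cover hη.radPeriod 0)
  rw [← h1, h0] at hsum
  have hfun : (fun k ↦ mFourier k (cover hη.radPeriod 0) • twCoeff hη.radPeriod (hη.radTwist hχ) (radSlice Φ η f x) k) =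
      fun m ↦ hη.radMode hχ f m x := by
    funext k
    rw [show cover hη.radPeriod (0 : radSpace Φ η) = cover hη.radPeriod ((0 : radSpace Φ η)) from rfl,
      hη.mFourier_cover_radPeriod, twistExp_apply, map_zero, Complex.ofReal_zero, mul_zero, Complex.exp_zero,
      one_smul, IsNSForm.radMode_apply]
  rw [hfun] at hsum
  exact hsum

/-- **`f = 0` iff all its modes vanish** (uniqueness of Fourier coefficients, slice by slice).
[cite: Grafakos2014, Prop. 3.2.4] -/
theorem IsRadSection.eq_zero_of_forall_radMode_eq_zero (hη : IsNSForm Φ η) (hχ : IsSemicharacter Φ η χ)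
    {f : E → ℂ} (hf : IsRadSection Φ η χ f) (h : ∀ m x, hη.radMode hχ f m x = 0) : f = 0 := by
  funext x
  have hs := hf.hasSum_radMode hη hχ x
  simp only [h] at hs
  exact (hasSum_zero.unique hs).symm ▸ rfl

/-- Modes are additive. [cite: Grafakos2014, Prop. 3.1.2 (1)] -/
theorem IsRadSection.radMode_add (hη : IsNSForm Φ η) (hχ : IsSemicharacter Φ η χ) {f g : E → ℂ}
    (hf : IsRadSection Φ η χ f) (hg : IsRadSection Φ η χ g) (m : Fin (subRank (nsRadical Φ η)) → ℤ) (x : E) :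
    hη.radMode hχ (f + g) m x = hη.radMode hχ f m x + hη.radMode hχ g m x := by
  rw [IsNSForm.radMode_apply, IsNSForm.radMode_apply, IsNSForm.radMode_apply,
    ← twCoeff_add (hη.radChar_eq_twistExp hχ) (hf.radSlice_mem hη x) (hg.radSlice_mem hη x)]
  rfl

/-- Modes are homogeneous. [cite: Grafakos2014, Prop. 3.1.2 (1)] -/
theorem IsNSForm.radMode_const_mul (hη : IsNSForm Φ η) (hχ : IsSemicharacter Φ η χ) (c : ℂ) (f : E → ℂ)
    (m : Fin (subRank (nsRadical Φ η)) → ℤ) (x : E) :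
    hη.radMode hχ (fun z ↦ c * f z) m x = c * hη.radMode hχ f m x := by
  rw [IsNSForm.radMode_apply, IsNSForm.radMode_apply, ← twCoeff_const_mul]
  rfl

/-! ### The translation law along the radical: modes are joint eigenfunctions of `K(L)⁰`-translations -/

/-- Untwisting a translated slice: `untwist θ (f_{x+w}) = e(2πiθ(w)) · (untwist θ f_x)(· + w)`. [folklore] -/
private theorem untwist_radSlice_add (hη : IsNSForm Φ η) (hχ : IsSemicharacter Φ η χ) (f : E → ℂ) (x : E)
    (w : radSpace Φ η) :
    untwist (hη.radTwist hχ) (radSlice Φ η f (x + w)) =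
      fun w' ↦ twistExp (hη.radTwist hχ) w * untwist (hη.radTwist hχ) (radSlice Φ η f x) (w' + w) := by
  funext w'
  rw [untwist_apply, untwist_apply, radSlice_add_coe, add_comm w w', twistExp_neg, twistExp_neg, twistExp_add]
  field_simp [twistExp_ne_zero]

/-- The descent of a translate is the translate of the descent: `desc(ψ(· + w)) = desc(ψ) ∘ (· + π w)` for
`Λ`-periodic `ψ`. [cite: Grafakos2014, Prop. 3.1.2 (6)] -/
theorem descendFun_comp_add {F : Type*} [NormedAddCommGroup F] [NormedSpace ℂ F] {κ : Type*} [Fintype κ]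
    (Ψ : (κ → ℝ) ≃L[ℝ] F) {ψ : F → ℂ} (hper : ∀ (z : F) (n : κ → ℤ), ψ (z + latticeVec Ψ n) = ψ z) (w : F) :
    descendFun Ψ (fun z ↦ ψ (z + w)) = fun y : ComplexTorus Ψ ↦ descendFun Ψ ψ (y + cover Ψ w) := by
  funext y
  obtain ⟨z, rfl⟩ := cover_surjective Ψ y
  have hper' : ∀ (z : F) (n : κ → ℤ), (fun z ↦ ψ (z + w)) (z + latticeVec Ψ n) = (fun z ↦ ψ (z + w)) z :=
    fun z n ↦ by simp only; rw [add_right_comm, hper]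
  rw [descendFun_cover Ψ hper', ← cover_add, descendFun_cover Ψ hper]

/-- Fourier coefficients of a translate on `ComplexTorus Ψ` (the tree's `Torus.mFourierCoeff_comp_add_right`, read
through the definitional identification `ComplexTorus Ψ = UnitAddTorus κ`). [cite: Grafakos2014, Prop. 3.1.2 (6)] -/
theorem mFourierCoeff_comp_add_cover {F : Type*} [NormedAddCommGroup F] [NormedSpace ℂ F] {κ : Type*} [Fintype κ]
    (Ψ : (κ → ℝ) ≃L[ℝ] F) (G : ComplexTorus Ψ → ℂ) (a : ComplexTorus Ψ) (m : κ → ℤ) :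
    mFourierCoeff (fun y : ComplexTorus Ψ ↦ G (y + a)) m = mFourier m a • mFourierCoeff G m :=
  Torus.mFourierCoeff_comp_add_right G a m

/-- **Translation law: `f^(m)(x + w) = e(2πi(θ + ρ_m)(w)) f^(m)(x)` for `w ∈ Φ(Λ(L)⁰)`** — the modes are joint
eigenfunctions of the translations by `K(L)⁰` (Fourier coefficients of a translate pick up the character,
Grafakos Prop. 3.1.2 (6)). [cite: Grafakos2014, Prop. 3.1.2 (6)] [cite: Lange2023AbelianVarietiesComplex, §1.6.3 Prop. 1.6.10] -/
theorem IsRadSection.radMode_add_coe (hη : IsNSForm Φ η) (hχ : IsSemicharacter Φ η χ) {f : E → ℂ}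
    (hf : IsRadSection Φ η χ f) (m : Fin (subRank (nsRadical Φ η)) → ℤ) (x : E) (w : radSpace Φ η) :
    hη.radMode hχ f m (x + w) =
      twistExp (hη.radTwist hχ) w * twistExp (hη.radFreq m) w * hη.radMode hχ f m x := by
  have hχθ := hη.radChar_eq_twistExp hχ
  have hper := untwist_add_latticeVec_of_mem_smoothTheta hχθ (hf.radSlice_mem hη x)
  rw [IsNSForm.radMode_apply, twCoeff_apply, untwist_radSlice_add, perCoeff_const_mul, perCoeff_apply,
    descendFun_comp_add hη.radPeriod hper, mFourierCoeff_comp_add_cover, hη.mFourier_cover_radPeriod,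
    IsNSForm.radMode_apply, twCoeff_apply, perCoeff_apply, smul_eq_mul, mul_assoc]

end Modes

/-! ## §5 The modes as kernel integrals: smoothness in `x`, derivatives commute with taking modes, the
translation law differentiated (`∂̄_w f^(m) = πi c_w(θ + ρ_m) f^(m)` for `w ∈ Φ(Λ(L)⁰)`), and modes of sections of
`L` are sections of `L` -/

section KernelIntegral

variable {ι : Type*} [Fintype ι] [DecidableEq ι] {E : Type*} [NormedAddCommGroup E] [NormedSpace ℂ E]
  {Φ : (ι → ℝ) ≃L[ℝ] E} {η : E [⋀^Fin 2]→L[ℝ] ℝ} {χ : (ι → ℤ) → ℂ}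

variable (Φ η) in
/-- A bounded measurable section of `π : ℝ^r → K(L)⁰`: the representative of a point of the torus in the unit cube
(the Sobolev trunk's `Torus.repr`, read in `ℝ^r`). Used only to write the modes as integrals with a smooth kernel.
[cite: Grafakos2014, §3.1.1] -/
def radRepr (y : UnitAddTorus (Fin (subRank (nsRadical Φ η)))) : Fin (subRank (nsRadical Φ η)) → ℝ :=
  EuclideanSpace.equiv (Fin (subRank (nsRadical Φ η))) ℝ (Torus.repr y)

omit [DecidableEq ι] in
/-- Coordinates of `radRepr`. [folklore] -/
private theorem radRepr_apply (y : UnitAddTorus (Fin (subRank (nsRadical Φ η)))) (i : Fin (subRank (nsRadical Φ η))) :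
    radRepr Φ η y i = Torus.repr y i := rfl

omit [DecidableEq ι] in
/-- `radRepr` is measurable. [cite: Grafakos2014, §3.1.1] -/
theorem measurable_radRepr : Measurable (radRepr Φ η) :=
  (EuclideanSpace.equiv _ ℝ).continuous.measurable.comp Torus.measurable_repr

omit [DecidableEq ι] in
/-- `radRepr` is bounded by `1` (coordinates in `[0, 1)`). [cite: Grafakos2014, §3.1.1] -/
theorem norm_radRepr_le (y : UnitAddTorus (Fin (subRank (nsRadical Φ η)))) : ‖radRepr Φ η y‖ ≤ 1 := by
  refine (pi_norm_le_iff_of_nonneg zero_le_one).2 fun i ↦ ?_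
  rw [radRepr_apply, Real.norm_eq_abs, abs_le]
  have h := Torus.repr_apply_mem_Ico y i
  exact ⟨by linarith [h.1], h.2.le⟩

/-- `radRepr` is a section of the covering `ℝ^r → Φ(Λ(L)⁰) → K(L)⁰`: `π(Ψ(repr y)) = y`. [cite: Grafakos2014, §3.1.1] -/
theorem cover_radPeriod_radRepr (hη : IsNSForm Φ η) (y : UnitAddTorus (Fin (subRank (nsRadical Φ η)))) :
    cover hη.radPeriod (hη.radPeriod (radRepr Φ η y)) = y := by
  rw [cover_apply_apply]
  funext i
  rw [proj_apply, radRepr_apply]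
  exact congrFun (Torus.proj_repr y) i

variable (hη : IsNSForm Φ η) (hχ : IsSemicharacter Φ η χ)
include hη hχ

/-- **The smooth kernel `A_f(X, s) = e(-2πiθ(Ψ s)) f(X + Ψ s)` on `V × ℝ^r`** against which the modes are
integrals over `K(L)⁰`. [cite: Grafakos2014, §3.1.1 (3.1.4)] -/
def IsNSForm.radKernel (f : E → ℂ) (p : E × (Fin (subRank (nsRadical Φ η)) → ℝ)) : ℂ :=
  twistExp (-hη.radTwist hχ) (hη.radPeriod p.2) * f (p.1 + (hη.radPeriod p.2 : E))

/-- Unfolding of `radKernel`. [cite: Grafakos2014, §3.1.1 (3.1.4)] -/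
theorem IsNSForm.radKernel_apply (f : E → ℂ) (p : E × (Fin (subRank (nsRadical Φ η)) → ℝ)) :
    hη.radKernel hχ f p = twistExp (-hη.radTwist hχ) (hη.radPeriod p.2) * f (p.1 + (hη.radPeriod p.2 : E)) := rfl

/-- The kernel is `C^∞` for `C^∞` `f`. [cite: Grafakos2014, §3.1.1 (3.1.4)] -/
theorem IsNSForm.contDiff_radKernel {f : E → ℂ} (hf : ContDiff ℝ ∞ f) : ContDiff ℝ ∞ (hη.radKernel hχ f) := by
  have hΨ : ContDiff ℝ ∞ fun p : E × (Fin (subRank (nsRadical Φ η)) → ℝ) ↦ hη.radPeriod p.2 :=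
    hη.radPeriod.contDiff.comp contDiff_snd
  refine ((contDiff_twistExp _).comp hΨ).mul (hf.comp (contDiff_fst.add ?_))
  exact ((radSpace Φ η).subtypeL.restrictScalars ℝ).contDiff.comp hΨ

/-- **The modes as integrals with a smooth kernel**: for a radical section `f`,
`f^(m)(x) = ∫_{K(L)⁰} A_f(x, s_y) \overline{e_m(y)} dy`, `s_y = repr y`. [cite: Grafakos2014, §3.1.1 (3.1.4)] -/
theorem IsRadSection.radMode_eq_integral {f : E → ℂ} (hf : IsRadSection Φ η χ f)
    (m : Fin (subRank (nsRadical Φ η)) → ℤ) (x : E) :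
    hη.radMode hχ f m x = ∫ y : UnitAddTorus (Fin (subRank (nsRadical Φ η))),
      hη.radKernel hχ f (x, radRepr Φ η y) * conj (mFourier m y) := by
  have hper := untwist_add_latticeVec_of_mem_smoothTheta (hη.radChar_eq_twistExp hχ) (hf.radSlice_mem hη x)
  rw [IsNSForm.radMode_apply, twCoeff_apply, perCoeff_apply, Torus.mFourierCoeff_eq_integral_conj_mul]
  refine MeasureTheory.integral_congr_ae (Filter.Eventually.of_forall fun y ↦ ?_)
  simp only
  rw [mul_comm, IsNSForm.radKernel_apply]
  congr 1
  conv_lhs => rw [← cover_radPeriod_radRepr hη y]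
  rw [descendFun_cover _ hper, untwist_apply, radSlice_apply]

/-- The modes as a function of `x`: `f^(m) = (X ↦ ∫ A_f(X, s_y) \overline{e_m(y)} dy)`. [cite: Grafakos2014, §3.1.1 (3.1.4)] -/
theorem IsRadSection.radMode_eq {f : E → ℂ} (hf : IsRadSection Φ η χ f) (m : Fin (subRank (nsRadical Φ η)) → ℤ) :
    hη.radMode hχ f m = fun X ↦ ∫ y : UnitAddTorus (Fin (subRank (nsRadical Φ η))),
      hη.radKernel hχ f (X, radRepr Φ η y) * conj (mFourier m y) :=
  funext (hf.radMode_eq_integral hη hχ m)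

/-- The derivative of the kernel in the `x`-direction: `D A_f (X, s) (v, 0) = A_{Df(·)[v]}(X, s)`. [cite: Grafakos2014, §3.1.1 (3.1.4)] -/
theorem IsNSForm.fderiv_radKernel_apply {f : E → ℂ} (hf : ContDiff ℝ ∞ f) (X v : E)
    (s : Fin (subRank (nsRadical Φ η)) → ℝ) :
    fderiv ℝ (hη.radKernel hχ f) (X, s) (v, 0) = hη.radKernel hχ (fun z ↦ fderiv ℝ f z v) (X, s) := by
  set g : E × (Fin (subRank (nsRadical Φ η)) → ℝ) → ℂ := fun p ↦ twistExp (-hη.radTwist hχ) (hη.radPeriod p.2) with hg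
  set L : E × (Fin (subRank (nsRadical Φ η)) → ℝ) →L[ℝ] E :=
    ContinuousLinearMap.fst ℝ E _ + ((radSpace Φ η).subtypeL.restrictScalars ℝ).comp
      ((hη.radPeriod : (Fin (subRank (nsRadical Φ η)) → ℝ) →L[ℝ] radSpace Φ η).comp (ContinuousLinearMap.snd ℝ E _)) with hL
  have hLapply : ∀ p : E × (Fin (subRank (nsRadical Φ η)) → ℝ), L p = p.1 + (hη.radPeriod p.2 : E) := fun p ↦ rfl
  have hgd : HasFDerivAt g ((fderiv ℝ (twistExp (-hη.radTwist hχ) ∘ hη.radPeriod) s).comp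
      (ContinuousLinearMap.snd ℝ E _)) (X, s) := by
    have h1 : DifferentiableAt ℝ (twistExp (-hη.radTwist hχ) ∘ hη.radPeriod) s :=
      (differentiableAt_twistExp _ _).comp s hη.radPeriod.differentiableAt
    have h2 : HasFDerivAt (Prod.snd : E × (Fin (subRank (nsRadical Φ η)) → ℝ) → _)
        (ContinuousLinearMap.snd ℝ E _) (X, s) := hasFDerivAt_snd
    exact h1.hasFDerivAt.comp (X, s) h2
  have hfd : HasFDerivAt (fun p : E × (Fin (subRank (nsRadical Φ η)) → ℝ) ↦ f (p.1 + (hη.radPeriod p.2 : E)))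
      ((fderiv ℝ f (X + (hη.radPeriod s : E))).comp L) (X, s) := by
    have h1 : HasFDerivAt f (fderiv ℝ f (L (X, s))) (L (X, s)) :=
      ((hf.differentiable (by simp)) _).hasFDerivAt
    have h2 : HasFDerivAt (fun p ↦ f (L p)) ((fderiv ℝ f (L (X, s))).comp L) (X, s) := h1.comp (X, s) L.hasFDerivAt
    simp only [hLapply] at h2
    exact h2
  have hprod := hgd.mul hfd
  rw [show hη.radKernel hχ f = g * (fun p : E × (Fin (subRank (nsRadical Φ η)) → ℝ) ↦
      f (p.1 + (hη.radPeriod p.2 : E))) from rfl, hprod.fderiv, IsNSForm.radKernel_apply]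
  simp only [add_apply, smul_apply, ContinuousLinearMap.coe_comp,
    Function.comp_apply, ContinuousLinearMap.coe_snd', map_zero, smul_eq_mul, mul_zero, add_zero, hLapply]
  simp [hg]

variable [FiniteDimensional ℂ E]

/-- **The modes of a radical section are `C^∞` in `x`** (differentiation under the integral sign against the
smooth kernel, `Literature.Analysis.Calculus.contDiff_integral_kernel_mul`). [cite: Grafakos2014, §3.1.1] -/
theorem IsRadSection.contDiff_radMode {f : E → ℂ} (hf : IsRadSection Φ η χ f)
    (m : Fin (subRank (nsRadical Φ η)) → ℤ) : ContDiff ℝ ∞ (hη.radMode hχ f m) := by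
  have hF : MeasureTheory.Integrable (fun y : UnitAddTorus (Fin (subRank (nsRadical Φ η))) ↦ conj (mFourier m y)) :=
    (continuous_conj.comp (mFourier m).continuous).integrable_unitAddTorus
  rw [hf.radMode_eq hη hχ m]
  exact Literature.Analysis.Calculus.contDiff_integral_kernel_mul (hη.contDiff_radKernel hχ hf.contDiff)
    measurable_radRepr.aestronglyMeasurable (Filter.Eventually.of_forall norm_radRepr_le) hF

/-- **Derivatives commute with taking modes**: `D(f^(m))(x)[v] = (z ↦ Df(z)[v])^(m)(x)` for every direction
`v ∈ V` (differentiation under the integral sign; `z ↦ Df(z)[v]` is again a radical section).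
[cite: Grafakos2014, Prop. 3.1.2 (8)] -/
theorem IsRadSection.fderiv_radMode_apply {f : E → ℂ} (hf : IsRadSection Φ η χ f)
    (m : Fin (subRank (nsRadical Φ η)) → ℤ) (x v : E) :
    fderiv ℝ (hη.radMode hχ f m) x v = hη.radMode hχ (fun z ↦ fderiv ℝ f z v) m x := by
  have hF : MeasureTheory.Integrable (fun y : UnitAddTorus (Fin (subRank (nsRadical Φ η))) ↦ conj (mFourier m y)) :=
    (continuous_conj.comp (mFourier m).continuous).integrable_unitAddTorus
  rw [hf.radMode_eq hη hχ m, Literature.Analysis.Calculus.fderiv_integral_kernel_mul_apply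
    (hη.contDiff_radKernel hχ hf.contDiff) measurable_radRepr.aestronglyMeasurable
    (Filter.Eventually.of_forall norm_radRepr_le) hF, (hf.fderiv_apply v).radMode_eq_integral hη hχ m x]
  refine MeasureTheory.integral_congr_ae (Filter.Eventually.of_forall fun y ↦ ?_)
  beta_reduce
  rw [hη.fderiv_radKernel_apply hχ hf.contDiff]

/-- **`∂̄_v` commutes with taking modes**: `∂̄_v(f^(m)) = (∂̄_v f)^(m)`. [cite: Grafakos2014, Prop. 3.1.2 (8)] -/
theorem IsRadSection.dbarAlong_radMode {f : E → ℂ} (hf : IsRadSection Φ η χ f)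
    (m : Fin (subRank (nsRadical Φ η)) → ℤ) (v x : E) :
    dbarAlong v (hη.radMode hχ f m) x = hη.radMode hχ (dbarAlong v f) m x := by
  have h : dbarAlong v f = fun z ↦ (1 / 2 : ℂ) * (((fun z ↦ fderiv ℝ f z v) + fun z ↦ I * fderiv ℝ f z (I • v)) z) := by
    funext z; rw [dbarAlong]; simp
  rw [h, hη.radMode_const_mul hχ, (hf.fderiv_apply v).radMode_add hη hχ ((hf.fderiv_apply (I • v)).const_mul I),
    hη.radMode_const_mul hχ, ← hf.fderiv_radMode_apply hη hχ, ← hf.fderiv_radMode_apply hη hχ, dbarAlong]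
  simp

/-- **`∂_v` commutes with taking modes**: `∂_v(f^(m)) = (∂_v f)^(m)`. [cite: Grafakos2014, Prop. 3.1.2 (8)] -/
theorem IsRadSection.delAlong_radMode {f : E → ℂ} (hf : IsRadSection Φ η χ f)
    (m : Fin (subRank (nsRadical Φ η)) → ℤ) (v x : E) :
    delAlong v (hη.radMode hχ f m) x = hη.radMode hχ (delAlong v f) m x := by
  have h : delAlong v f = fun z ↦ (1 / 2 : ℂ) * (((fun z ↦ fderiv ℝ f z v) + fun z ↦ (-I) * fderiv ℝ f z (I • v)) z) := by
    funext z; rw [delAlong]; simp; ring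
  rw [h, hη.radMode_const_mul hχ, (hf.fderiv_apply v).radMode_add hη hχ ((hf.fderiv_apply (I • v)).const_mul (-I)),
    hη.radMode_const_mul hχ, ← hf.fderiv_radMode_apply hη hχ, ← hf.fderiv_radMode_apply hη hχ, delAlong]
  simp; ring

/-! ### The translation law, differentiated -/

/-- **`D(f^(m))(x)[w] = 2πi (θ + ρ_m)(w) f^(m)(x)` for `w ∈ Φ(Λ(L)⁰)`**: along the radical the modes are
exponentials (the translation law `radMode_add_coe`, differentiated at `t = 0` along `t ↦ x + t w`).
[cite: Grafakos2014, Prop. 3.1.2 (6), (8)] -/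
theorem IsRadSection.fderiv_radMode_coe {f : E → ℂ} (hf : IsRadSection Φ η χ f)
    (m : Fin (subRank (nsRadical Φ η)) → ℤ) (x : E) (w : radSpace Φ η) :
    fderiv ℝ (hη.radMode hχ f m) x (w : E) =
      2 * π * I * ((hη.radTwist hχ w + hη.radFreq m w : ℝ) : ℂ) * hη.radMode hχ f m x := by
  set c := hη.radMode hχ f m x with hc
  set a : ℝ := hη.radTwist hχ w + hη.radFreq m w with ha
  -- the line `t ↦ x + t • w` and the explicit form of the mode along it
  have hline : ∀ t : ℝ, hη.radMode hχ f m (x + t • (w : E)) = cexp (2 * π * I * (a * t : ℝ)) * c := by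
    intro t
    rw [show x + t • (w : E) = x + ((t • w : radSpace Φ η) : E) by simp, hf.radMode_add_coe hη hχ,
      twistExp_apply, twistExp_apply, ← Complex.exp_add, map_smul, map_smul, smul_eq_mul, smul_eq_mul, ha]
    congr 1
    push_cast
    ring
  -- derivative of the explicit form at `t = 0`
  have hexp : HasDerivAt (fun t : ℝ ↦ cexp (2 * π * I * (a * t : ℝ)) * c) (2 * π * I * a * c) 0 := by
    have h1 : HasDerivAt (fun t : ℝ ↦ 2 * π * I * (a * t : ℝ)) (2 * π * I * a) 0 := by
      have h0 : HasDerivAt (fun t : ℝ ↦ ((a * t : ℝ) : ℂ)) (a : ℂ) 0 := by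
        have := ((hasDerivAt_id (0 : ℝ)).const_mul a).ofReal_comp
        simpa using this
      simpa using h0.const_mul (2 * π * I)
    have h2 := h1.cexp.mul_const c
    simpa using h2
  -- derivative of the mode along the line by the chain rule
  have hdiff : DifferentiableAt ℝ (hη.radMode hχ f m) x :=
    ((hf.contDiff_radMode hη hχ m).differentiable (by simp)) x
  have hchain : HasDerivAt (fun t : ℝ ↦ hη.radMode hχ f m (x + t • (w : E)))
      (fderiv ℝ (hη.radMode hχ f m) x (w : E)) 0 := by
    have hl : HasDerivAt (fun t : ℝ ↦ x + t • (w : E)) (w : E) 0 := by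
      simpa using ((hasDerivAt_id (0 : ℝ)).smul_const (w : E)).const_add x
    exact hdiff.hasFDerivAt.comp_hasDerivAt_of_eq 0 hl (by simp)
  have heq : (fun t : ℝ ↦ hη.radMode hχ f m (x + t • (w : E))) = fun t ↦ cexp (2 * π * I * (a * t : ℝ)) * c :=
    funext hline
  rw [heq] at hchain
  rw [hchain.unique hexp]

/-- **`∂̄_w f^(m) = πi c_w(θ + ρ_m) f^(m)` for `w ∈ Φ(Λ(L)⁰)`** — the modes diagonalise every `∂̄_w` along the
radical, with symbol `c_w(ρ) = ρ(w) + iρ(iw)` (row A2-82 `dbarSymb`). [cite: Lange2023AbelianVarietiesComplex, §1.6.1 p0064] [cite: Grafakos2014, Prop. 3.1.2 (8)] -/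
theorem IsRadSection.dbarAlong_coe_radMode {f : E → ℂ} (hf : IsRadSection Φ η χ f)
    (m : Fin (subRank (nsRadical Φ η)) → ℤ) (x : E) (w : radSpace Φ η) :
    dbarAlong (w : E) (hη.radMode hχ f m) x =
      π * I * dbarSymb (hη.radTwist hχ + hη.radFreq m) w * hη.radMode hχ f m x := by
  rw [dbarAlong, show I • (w : E) = ((I • w : radSpace Φ η) : E) by simp, hf.fderiv_radMode_coe hη hχ,
    hf.fderiv_radMode_coe hη hχ, dbarSymb_apply]
  simp only [FunLike.coe_add, Pi.add_apply, smul_eq_mul]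
  push_cast
  ring

/-- **`∂_w f^(m) = πi \overline{c_w(θ + ρ_m)} f^(m)` for `w ∈ Φ(Λ(L)⁰)`.** [cite: Lange2023AbelianVarietiesComplex, §1.6.1 p0064] -/
theorem IsRadSection.delAlong_coe_radMode {f : E → ℂ} (hf : IsRadSection Φ η χ f)
    (m : Fin (subRank (nsRadical Φ η)) → ℤ) (x : E) (w : radSpace Φ η) :
    delAlong (w : E) (hη.radMode hχ f m) x =
      π * I * conj (dbarSymb (hη.radTwist hχ + hη.radFreq m) w) * hη.radMode hχ f m x := by
  rw [delAlong, show I • (w : E) = ((I • w : radSpace Φ η) : E) by simp, hf.fderiv_radMode_coe hη hχ,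
    hf.fderiv_radMode_coe hη hχ, dbarSymb_apply]
  simp only [FunLike.coe_add, Pi.add_apply, map_add, map_mul, Complex.conj_ofReal, Complex.conj_I]
  push_cast
  ring

/-! ### Modes of sections of `L` are sections of `L` -/

omit [Fintype ι] [DecidableEq ι] [FiniteDimensional ℂ E] hχ in
/-- The canonical factor is constant along the radical: `a_L(λ, x + w) = a_L(λ, x)` for `w ∈ Φ(Λ(L)⁰)`
(`H(w, λ) = 0`). [cite: Lange2023AbelianVarietiesComplex, §1.6.3 Prop. 1.6.10 (Step 1)] -/
theorem canonicalFactor_add_coe (n : ι → ℤ) (x : E) (w : radSpace Φ η) :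
    canonicalFactor Φ η χ n (x + w) = canonicalFactor Φ η χ n x := by
  have hw : Φ.symm (w : E) ∈ nsRadical Φ η :=
    (mem_cxSpan_iff (isComplexSubspace_nsRadical Φ hη.type_one_one)).1 w.2
  have h0 : hermOf η (w : E) (latticeVec Φ n) = 0 := by
    have h := (mem_nsRadical_iff_hermOf Φ hη.type_one_one).1 hw (latticeVec Φ n)
    rwa [ContinuousLinearEquiv.apply_symm_apply] at h
  rw [canonicalFactor_apply, canonicalFactor_apply, hermOf_add_left, h0, add_zero]

/-- **The modes of a smooth section of `L(H, χ)` are smooth sections of `L(H, χ)`**: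
`f^(m)(x + λ) = a_L(λ, x) f^(m)(x)` (the slice through `x + λ` is `a_L(λ, x)` times the slice through `x`, the
canonical factor being constant along the radical), and `f^(m)` is `C^∞`.
[cite: Lange2023AbelianVarietiesComplex, §1.6.3 Prop. 1.6.10] -/
theorem IsNSForm.radMode_mem_smoothTheta {f : E → ℂ} (hf : f ∈ smoothTheta Φ (canonicalFactor Φ η χ))
    (m : Fin (subRank (nsRadical Φ η)) → ℤ) :
    hη.radMode hχ f m ∈ smoothTheta Φ (canonicalFactor Φ η χ) := by
  have hrs := IsRadSection.of_mem_smoothTheta (χ := χ) hη.type_one_one hf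
  refine ⟨hrs.contDiff_radMode hη hχ m, fun n x ↦ ?_⟩
  have hslice : radSlice Φ η f (x + latticeVec Φ n) = fun w ↦ canonicalFactor Φ η χ n x * radSlice Φ η f x w := by
    funext w
    rw [radSlice_apply, radSlice_apply, add_right_comm, hf.2, canonicalFactor_add_coe hη]
  rw [IsNSForm.radMode_apply, hslice, twCoeff_const_mul, IsNSForm.radMode_apply]

end KernelIntegral

/-! ## §6 The operators `δ̄_v` and `Δ_I` of Lange's §1.6.1 commute with taking modes; on the radical directions
`δ̄_w ∂̄_w f^(m) = π² |c_w(θ + ρ_m)|² f^(m)` -/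

section Laplacian

variable {ι : Type*} [Fintype ι] [DecidableEq ι] {E : Type*} [NormedAddCommGroup E] [NormedSpace ℂ E]
  {Φ : (ι → ℝ) ≃L[ℝ] E} {η : E [⋀^Fin 2]→L[ℝ] ℝ} {χ : (ι → ℤ) → ℂ}
  (hη : IsNSForm Φ η) (hχ : IsSemicharacter Φ η χ)
include hη

omit [Fintype ι] [DecidableEq ι] in
/-- `H(w, x) = 0` for `w ∈ Φ(Λ(L)⁰)` ((1.22): the radical of `E` is the radical of `H`).
[cite: Lange2023AbelianVarietiesComplex, §1.5.4 (1.22)] -/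
theorem IsNSForm.hermOf_coe_radSpace (w : radSpace Φ η) (x : E) : hermOf η (w : E) x = 0 := by
  have hw : Φ.symm (w : E) ∈ nsRadical Φ η :=
    (mem_cxSpan_iff (isComplexSubspace_nsRadical Φ hη.type_one_one)).1 w.2
  have h := (mem_nsRadical_iff_hermOf Φ hη.type_one_one).1 hw x
  rwa [ContinuousLinearEquiv.apply_symm_apply] at h

omit [Fintype ι] [DecidableEq ι] in
/-- `H(x, w) = 0` for `w ∈ Φ(Λ(L)⁰)`. [cite: Lange2023AbelianVarietiesComplex, §1.5.4 (1.22)] -/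
theorem IsNSForm.hermOf_coe_radSpace_right (x : E) (w : radSpace Φ η) : hermOf η x (w : E) = 0 := by
  rw [hermOf_swap η hη.type_one_one, hη.hermOf_coe_radSpace, map_zero]

omit [Fintype ι] [DecidableEq ι] in
/-- **On the radical directions `δ̄_w = -∂_w`** (Lemma 1.6.2 (a) with `H(w, ·) = 0`).
[cite: Lange2023AbelianVarietiesComplex, §1.6.1 Lemma 1.6.2] -/
theorem IsNSForm.deltaBar_coe_radSpace (w : radSpace Φ η) (u : E → ℂ) (x : E) :
    deltaBar η (w : E) u x = -delAlong (w : E) u x := by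
  rw [deltaBar_apply, hη.hermOf_coe_radSpace, mul_zero, zero_mul, add_zero]

omit [DecidableEq ι] in
/-- `z ↦ H(v, z) f(z)` is a radical section when `f` is (`H(v, ·)` is `Λ(L)⁰`-invariant).
[cite: Lange2023AbelianVarietiesComplex, §1.6.1 Lemma 1.6.2] -/
theorem IsRadSection.hermOf_mul {f : E → ℂ} (hf : IsRadSection Φ η χ f) (v : E) :
    IsRadSection Φ η χ (fun z ↦ hermOf η v z * f z) := by
  refine ⟨(contDiff_hermOf_right hη.type_one_one v).mul hf.contDiff, fun n z ↦ ?_⟩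
  rw [hermOf_add_right, hermOf_latticeVec_subtorusMatrix_mulVec Φ η hη.type_one_one, add_zero, hf.periodic]
  ring

include hχ

/-- **Multiplication by `H(v, ·)` commutes with taking modes**: `(H(v,·) f)^(m)(x) = H(v, x) f^(m)(x)` (`H(v, ·)` is
constant on the slice `x + Φ(Λ(L)⁰)`). [cite: Lange2023AbelianVarietiesComplex, §1.6.1 Lemma 1.6.2] -/
theorem IsNSForm.radMode_hermOf_mul (f : E → ℂ) (v : E) (m : Fin (subRank (nsRadical Φ η)) → ℤ) (x : E) :
    hη.radMode hχ (fun z ↦ hermOf η v z * f z) m x = hermOf η v x * hη.radMode hχ f m x := by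
  have hslice : radSlice Φ η (fun z ↦ hermOf η v z * f z) x = fun w ↦ hermOf η v x * radSlice Φ η f x w := by
    funext w
    rw [radSlice_apply, radSlice_apply, hermOf_add_right, hη.hermOf_coe_radSpace_right, add_zero]
  rw [IsNSForm.radMode_apply, hslice, twCoeff_const_mul, IsNSForm.radMode_apply]

variable [FiniteDimensional ℂ E]

/-- **`δ̄_v` commutes with taking modes**, for every `v ∈ V`: `δ̄_v(f^(m)) = (δ̄_v f)^(m)`.
[cite: Lange2023AbelianVarietiesComplex, §1.6.1 Lemma 1.6.2] -/
theorem IsRadSection.deltaBar_radMode {f : E → ℂ} (hf : IsRadSection Φ η χ f)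
    (m : Fin (subRank (nsRadical Φ η)) → ℤ) (v x : E) :
    deltaBar η v (hη.radMode hχ f m) x = hη.radMode hχ (deltaBar η v f) m x := by
  have h : deltaBar η v f = (fun z ↦ (-1 : ℂ) * delAlong v f z) + fun z ↦ hermOf η v z * ((π : ℂ) * f z) := by
    funext z; rw [Pi.add_apply, deltaBar_apply]; ring
  rw [h, ((isRadSection_delAlong hf v).const_mul (-1)).radMode_add hη hχ ((hf.const_mul π).hermOf_mul hη v),
    hη.radMode_const_mul hχ, hη.radMode_hermOf_mul hχ, hη.radMode_const_mul hχ, ← hf.delAlong_radMode hη hχ,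
    deltaBar_apply]
  ring

omit [FiniteDimensional ℂ E] in
/-- Modes of finite sums of radical sections. [cite: Grafakos2014, Prop. 3.1.2 (1)] -/
theorem IsNSForm.radMode_finset_sum {α : Type*} (s : Finset α) {F : α → E → ℂ}
    (hF : ∀ i ∈ s, IsRadSection Φ η χ (F i)) (m : Fin (subRank (nsRadical Φ η)) → ℤ) (x : E) :
    hη.radMode hχ (fun z ↦ ∑ i ∈ s, F i z) m x = ∑ i ∈ s, hη.radMode hχ (F i) m x := by
  classical
  induction s using Finset.induction_on with
  | empty =>
    simp only [Finset.sum_empty]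
    have h := hη.radMode_const_mul hχ 0 (fun _ ↦ (0 : ℂ)) m x
    simp only [zero_mul] at h
    exact h
  | insert a s ha ih =>
    have hF' : ∀ i ∈ s, IsRadSection Φ η χ (F i) := fun i hi ↦ hF i (Finset.mem_insert_of_mem hi)
    simp only [Finset.sum_insert ha]
    rw [show (fun z ↦ F a z + ∑ i ∈ s, F i z) = F a + fun z ↦ ∑ i ∈ s, F i z from rfl,
      (hF a (Finset.mem_insert_self a s)).radMode_add hη hχ (IsRadSection.finset_sum s hF'), ih hF']

/-- **Lange's Laplacian `Δ_I` (Prop. 1.6.3) commutes with taking modes**: `Δ_I(f^(m)) = (Δ_I f)^(m)` for every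
frame `b`, weights `k` and multi-index `I` — the mode decomposition along `K(L)⁰` reduces `Δ`.
[cite: Lange2023AbelianVarietiesComplex, §1.6.1 Prop. 1.6.3] -/
theorem IsRadSection.laplaceI_radMode {g : ℕ} (b : Fin g → E) (k : Fin g → ℝ) (I : Finset (Fin g)) {f : E → ℂ}
    (hf : IsRadSection Φ η χ f) (m : Fin (subRank (nsRadical Φ η)) → ℤ) (x : E) :
    laplaceI η b k I (hη.radMode hχ f m) x = hη.radMode hχ (laplaceI η b k I f) m x := by
  -- each term `k_ν⁻¹ δ̄_ν ∂̄_ν f` is a radical section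
  have hterm : ∀ ν, IsRadSection Φ η χ (fun z ↦ (((k ν)⁻¹ : ℝ) : ℂ) * deltaBar η (b ν) (dbarAlong (b ν) f) z) := by
    intro ν
    have h1 := isRadSection_dbarAlong hf (b ν)
    have h : deltaBar η (b ν) (dbarAlong (b ν) f) =
        (fun z ↦ (-1 : ℂ) * delAlong (b ν) (dbarAlong (b ν) f) z) +
          fun z ↦ hermOf η (b ν) z * ((π : ℂ) * dbarAlong (b ν) f z) := by
      funext z; rw [Pi.add_apply, deltaBar_apply]; ring
    refine IsRadSection.const_mul ?_ _
    rw [h]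
    exact ((isRadSection_delAlong h1 _).const_mul _).add ((h1.const_mul _).hermOf_mul hη _)
  have hsum : IsRadSection Φ η χ (fun z ↦ ∑ ν, (((k ν)⁻¹ : ℝ) : ℂ) * deltaBar η (b ν) (dbarAlong (b ν) f) z) :=
    IsRadSection.finset_sum Finset.univ fun ν _ ↦ hterm ν
  have hconst := hf.const_mul (π * ∑ ν ∈ I, (((k ν)⁻¹ : ℝ) : ℂ) * hermOf η (b ν) (b ν))
  have hsplit : laplaceI η b k I f = (fun z ↦ ∑ ν, (((k ν)⁻¹ : ℝ) : ℂ) * deltaBar η (b ν) (dbarAlong (b ν) f) z) +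
      fun z ↦ (π * ∑ ν ∈ I, (((k ν)⁻¹ : ℝ) : ℂ) * hermOf η (b ν) (b ν)) * f z := by
    funext z; rw [Pi.add_apply, laplaceI_apply]
  rw [hsplit, hsum.radMode_add hη hχ hconst, hη.radMode_finset_sum hχ _ (fun ν _ ↦ hterm ν), hη.radMode_const_mul hχ,
    laplaceI_apply]
  congr 1
  refine Finset.sum_congr rfl fun ν _ ↦ ?_
  rw [hη.radMode_const_mul hχ, show dbarAlong (b ν) (hη.radMode hχ f m) = hη.radMode hχ (dbarAlong (b ν) f) m from
    funext fun y ↦ hf.dbarAlong_radMode hη hχ m (b ν) y, (isRadSection_dbarAlong hf (b ν)).deltaBar_radMode hη hχ]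

/-- **On the radical directions the modes diagonalise `δ̄_w ∂̄_w`**:
`δ̄_w ∂̄_w f^(m) = π² |c_w(θ + ρ_m)|² f^(m)` for `w ∈ Φ(Λ(L)⁰)` (`δ̄_w = -∂_w` there, and `∂̄_w`, `∂_w` act on `f^(m)`
by the scalars `πi c_w`, `πi \overline{c_w}`). This is the symbol of the `K(L)⁰`-part of Lange's `Δ_I`.
[cite: Lange2023AbelianVarietiesComplex, §1.6.1 Prop. 1.6.3] [cite: Grafakos2014, Prop. 3.1.2 (8)] -/
theorem IsRadSection.deltaBar_dbarAlong_coe_radMode {f : E → ℂ} (hf : IsRadSection Φ η χ f)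
    (m : Fin (subRank (nsRadical Φ η)) → ℤ) (x : E) (w : radSpace Φ η) :
    deltaBar η (w : E) (dbarAlong (w : E) (hη.radMode hχ f m)) x =
      ((π ^ 2 * Complex.normSq (dbarSymb (hη.radTwist hχ + hη.radFreq m) w) : ℝ) : ℂ) * hη.radMode hχ f m x := by
  have hfun : dbarAlong (w : E) (hη.radMode hχ f m) =
      fun x ↦ (π * I * dbarSymb (hη.radTwist hχ + hη.radFreq m) w) * hη.radMode hχ f m x :=
    funext fun x ↦ hf.dbarAlong_coe_radMode hη hχ m x w
  have hd : DifferentiableAt ℝ (hη.radMode hχ f m) x := ((hf.contDiff_radMode hη hχ m).differentiable (by simp)) x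
  rw [hfun, hη.deltaBar_coe_radSpace, delAlong_const_mul hd, hf.delAlong_coe_radMode hη hχ]
  push_cast
  rw [Complex.normSq_eq_conj_mul_self]
  linear_combination (-(↑π ^ 2 * dbarSymb (hη.radTwist hχ + hη.radFreq m) w *
    conj (dbarSymb (hη.radTwist hχ + hη.radFreq m) w) * hη.radMode hχ f m x)) * Complex.I_sq

end Laplacian

end ComplexTorus

end Literature.Geometry.Kaehler
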